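import Mathlib.MeasureTheory.Measure.Support
import Literature.Dynamics.Ergodic.BirkhoffErgodicTheoremProofs

/-!
# Route MomentParity · `GalerkinEnsembleRealization` — Birkhoff–Chebyshev selection of a good path

Abstract selection step (stmt-AnomalousDissipation-11466): on a probability space with a
measure-preserving map `θ`, two nonnegative integrable observables `F_e` (energy) and `F_d`
(dissipation) with `∫ F_e ≤ E`, `∫ F_d ≥ D`, whose Birkhoff averages satisfy along every point of
the support the *pathwise coupling* `A_n F_d ≤ c₀/n + A √(A_n F_e)` (the time-averaged energy
inequality), there is a point of the support at which both Birkhoff averages converge, to limits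
`e* ≤ M` and `d* ≥ D'`, as soon as `D' + A E / √M < D` (Birkhoff's pointwise ergodic theorem,
`Literature.Dynamics.Ergodic.birkhoff_ergodic_theorem_holds`, and Chebyshev's inequality against the
coupling `d* ≤ A √e*`, i.e. `d* 𝟙{e* > M} ≤ A e*/√M`).
-/

noncomputable section

open MeasureTheory Set Filter Topology Function

namespace Summit.AnomalousDissipation.AnomalousDissipation.Theorems.MomentParity

set_option linter.dupNamespace false

/-- **Birkhoff–Chebyshev selection.** See the module docstring. -/
theorem exists_mem_support_birkhoff_limits {X : Type*} [MeasurableSpace X] [TopologicalSpace X]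
    [HereditarilyLindelofSpace X] (Q : Measure X) [IsProbabilityMeasure Q] {θ : X → X}
    (hθ : MeasurePreserving θ Q Q) {Fe Fd : X → ℝ} (hFe : Integrable Fe Q) (hFd : Integrable Fd Q)
    (hFe0 : ∀ x, 0 ≤ Fe x) (hFd0 : ∀ x, 0 ≤ Fd x) {A c₀ E D D' M : ℝ} (hA : 0 ≤ A)
    (hEint : ∫ x, Fe x ∂Q ≤ E) (hDint : D ≤ ∫ x, Fd x ∂Q) (hM : 0 < M) (hD'0 : 0 ≤ D')
    (hgap : D' + A * E / Real.sqrt M < D)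
    (hcouple : ∀ x ∈ Q.support, ∀ n : ℕ, 0 < n →
      birkhoffAverage ℝ θ Fd n x ≤ c₀ / n + A * Real.sqrt (birkhoffAverage ℝ θ Fe n x)) :
    ∃ x ∈ Q.support, ∃ e d : ℝ,
      Tendsto (fun n => birkhoffAverage ℝ θ Fe n x) atTop (𝓝 e) ∧
      Tendsto (fun n => birkhoffAverage ℝ θ Fd n x) atTop (𝓝 d) ∧ e ≤ M ∧ D' ≤ d := by
  -- Birkhoff for the two observables
  obtain ⟨es, hes_int, -, hes_eq, hes_lim⟩ :=
    Literature.Dynamics.Ergodic.birkhoff_ergodic_theorem_holds Q θ hθ Fe hFe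
  obtain ⟨ds, hds_int, -, hds_eq, hds_lim⟩ :=
    Literature.Dynamics.Ergodic.birkhoff_ergodic_theorem_holds Q θ hθ Fd hFd
  have hsupp : ∀ᵐ x ∂Q, x ∈ Q.support := Measure.support_mem_ae
  -- nonnegativity of the averages and of the limits
  have havg_nonneg : ∀ (F : X → ℝ), (∀ x, 0 ≤ F x) → ∀ n x, 0 ≤ birkhoffAverage ℝ θ F n x := by
    intro F hF n x
    rw [birkhoffAverage, birkhoffSum]
    exact smul_nonneg (inv_nonneg.2 n.cast_nonneg) (Finset.sum_nonneg fun i _ => hF _)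
  -- the coupling passes to the limit: `d* ≤ A √e*`
  have hcouple_lim : ∀ᵐ x ∂Q, ds x ≤ A * Real.sqrt (es x) ∧ 0 ≤ es x ∧ 0 ≤ ds x := by
    filter_upwards [hsupp, hes_lim, hds_lim] with x hx hxe hxd
    refine ⟨?_, ge_of_tendsto' hxe fun n => havg_nonneg Fe hFe0 n x,
      ge_of_tendsto' hxd fun n => havg_nonneg Fd hFd0 n x⟩
    have h1 : Tendsto (fun n : ℕ => c₀ / n + A * Real.sqrt (birkhoffAverage ℝ θ Fe n x)) atTop
        (𝓝 (0 + A * Real.sqrt (es x))) :=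
      (tendsto_const_div_atTop_nhds_zero_nat c₀).add ((hxe.sqrt).const_mul A)
    rw [zero_add] at h1
    exact le_of_tendsto_of_tendsto hxd h1 (eventually_atTop.2 ⟨1, fun n hn => hcouple x hx n hn⟩)
  -- Chebyshev: if no good point existed, `d* ≤ D' + A e* / √M` a.e., contradicting `∫ d* ≥ D`
  by_contra hno
  push Not at hno
  have hbad : ∀ᵐ x ∂Q, ds x ≤ D' + A / Real.sqrt M * es x := by
    filter_upwards [hsupp, hes_lim, hds_lim, hcouple_lim] with x hx hxe hxd ⟨hc, he0, hd0⟩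
    have hAM : 0 ≤ A / Real.sqrt M * es x := mul_nonneg (div_nonneg hA (Real.sqrt_nonneg _)) he0
    by_cases hcase : es x ≤ M
    · -- then `d* < D'`
      have h := hno x hx (es x) (ds x) hxe hxd hcase
      linarith
    · -- `e* > M`: `√e* ≤ e*/√M`
      push Not at hcase
      have hsqM : 0 < Real.sqrt M := Real.sqrt_pos.2 hM
      have h1 : Real.sqrt (es x) ≤ es x / Real.sqrt M := by
        rw [le_div_iff₀ hsqM, ← Real.sqrt_mul he0]
        calc Real.sqrt (es x * M) ≤ Real.sqrt (es x * es x) := Real.sqrt_le_sqrt (by nlinarith)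
          _ = es x := Real.sqrt_mul_self he0
      have h2 : A * Real.sqrt (es x) ≤ A / Real.sqrt M * es x := by
        calc A * Real.sqrt (es x) ≤ A * (es x / Real.sqrt M) := mul_le_mul_of_nonneg_left h1 hA
          _ = A / Real.sqrt M * es x := by ring
      have hD'M : ds x ≤ A / Real.sqrt M * es x := hc.trans h2
      linarith
  -- integrate
  have hint_bad : ∫ x, ds x ∂Q ≤ D' + A / Real.sqrt M * ∫ x, es x ∂Q := by
    have h := integral_mono_ae hds_int ((integrable_const D').add (hes_int.const_mul (A / Real.sqrt M))) hbad
    have h2 : ∫ x, (fun _ => D') x + (fun x => A / Real.sqrt M * es x) x ∂Q = D' + A / Real.sqrt M * ∫ x, es x ∂Q := by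
      rw [integral_add (integrable_const D') (hes_int.const_mul _), integral_const, integral_const_mul,
        probReal_univ, one_smul]
    exact h.trans h2.le
  have hAM0 : 0 ≤ A / Real.sqrt M := div_nonneg hA (Real.sqrt_nonneg _)
  have h3 : A / Real.sqrt M * ∫ x, es x ∂Q ≤ A * E / Real.sqrt M := by
    rw [hes_eq]
    calc A / Real.sqrt M * ∫ x, Fe x ∂Q ≤ A / Real.sqrt M * E := mul_le_mul_of_nonneg_left hEint hAM0
      _ = A * E / Real.sqrt M := by ring
  rw [hds_eq] at hint_bad
  linarith

end Summit.AnomalousDissipation.AnomalousDissipation.Theorems.MomentParity
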